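import Mathlib.Analysis.SpecialFunctions.Pow.Real
import Mathlib.Algebra.Order.BigOperators.Ring.Finset
import Mathlib.Algebra.BigOperators.Ring.Finset
import Mathlib.Data.Fintype.BigOperators
import Literature.Probability.RandomGraphs.LowDegree
import HarnessLib

/-!
# Lindsey's lemma for the inner product function

The discrepancy bound for the inner product function `IP_n(x,y) = Σᵢ xᵢyᵢ mod 2` under the
uniform distribution (Chor–Goldreich 1988; Kushilevitz–Nisan, Example 3.29), in the form of
Lindsey's lemma for the `2^n × 2^n` Sylvester–Hadamard matrix `H(x,y) = (-1)^{IP_n(x,y)}`: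
"The absolute value of the sum of all entries in any `a × b` submatrix of an `n × n` Hadamard
matrix `H` does not exceed `√(abn)`" (Jukna 2012, Appendix A), and "for every `x ≠ 0`,
`IP_n(x,y) = 1` for exactly half of vectors `y`. Hence, `H` is a Hadamard matrix" (Jukna 2012,
proof of Cor. 11.35).

* `ipSign x y = Πᵢ (if xᵢ ∧ yᵢ then -1 else 1) = (-1)^{#{i | xᵢ ∧ yᵢ}}` (`ipSign_eq_pow`); it is
  the Walsh character `walsh {i | xᵢ = 1} y` of the tree's Boolean-Fourier file
  `Literature/Probability/RandomGraphs/LowDegree.lean` (`ipSign_eq_walsh`, with the support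
  bijection `boolFunEquivFinset : (n → Bool) ≃ Finset n`), whence the character property
  `H(x,y)H(x,y') = H(x,y ⊕ y')` and the orthogonality of the rows (`sum_ipSign`:
  `Σ_x H(x,w) = 2^n [w = 0]`, from `LowDegree.sum_walsh_mul_walsh`).
* `lindsey_sq`: the weighted, squared form `(Σ_{x,y} a_x b_y H(x,y))² ≤ (Σ a_x²)·2^n·(Σ b_y²)`
  (Cauchy–Schwarz and `HHᵀ = 2^n I`), for arbitrary real weights — with `a = 1_S`, `b = 1_T`
  this is the printed `√(|S||T|2^n)` bound.
* `lindsey`: for weights bounded by `1` in absolute value,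
  `|Σ_{x,y} a_x b_y H(x,y)| ≤ 2^n · √2^n`, i.e. discrepancy `≤ 2^{-n/2}` after normalising by
  `4^n`. This is the input to the `ε`-sensitive lower bound of
  Chattopadhyay–Datta–Ghosal–Mukhopadhyay 2022 (their Thm. 2.2).

Vectors are `x : n → Bool` over a finite index type `n`; everything is over `ℝ`.

## Relation to the tree

* `ipSign` is, at `n = Fin k`, byte-for-byte the `twist` of
  `Literature/Computability/QuantumComplexity/Forrelation.lean`
  (`Literature.Computability.QuantumComplexity.twist x y = ∏ l, if x l && y l then -1 else 1`,
  so `twist x y = ipSign x y` holds by `rfl`). The present file is the general-`n`,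
  Mathlib-plus-`LowDegree` survivor: the `Fin k` lemmas `twist_eq_neg_one_pow`
  (`SimonFourier.lean`), `twist_eq_walsh`, `twist_sq`, `abs_twist` (`Forrelation.lean`),
  `twist_xor_left` (with `twist_comm`) and `sum_twist` (`SimonFourier.lean`) are the instances
  of `ipSign_eq_pow`, `ipSign_eq_walsh`, `ipSign_sq`, `abs_ipSign`, `ipSign_mul_ipSign`,
  `sum_ipSign`. `twist` sits on top of the circuit/promise-problem imports of the quantum files,
  so the bridge `twist_eq_ipSign : twist x y = ipSign x y := rfl` cannot live here without
  inverting the layering; it belongs in the first module importing both, or in a librarian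
  refactor making `twist` an `abbrev` of `ipSign`. The same Hadamard sign appears a third time as
  `hadamardSign` (`QuantumComplexity/RazTalForrelation.lean`, `twist` on the bit vectors of
  `Fin (2^n)`).
* `Literature.Barriers.ValiantsHypothesis.ip` (`SpanningTreeGadget.lean`) is CDGM's `IP_k` as a
  `Bool`; its consumer (the `ε`-sensitive bound of CDGM 2022) connects the two by
  `ipSign x y = if ip x y then -1 else 1`, proved there.
* `boolFunEquivFinset : (n → Bool) ≃ Finset n` generalises three `Fin`-specialised copies in the
  tree (`outcomeEquivFinset` in `ArthurMerlinParallelPlay.lean`, `posSetEquiv` in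
  `DirectProductDecoder.lean`, `patternEquiv` in `RazTalMachine.lean`) — refactor candidates.

## References

* [Jukna2012] S. Jukna, *Boolean Function Complexity*, Springer 2012, Appendix A (Lindsey's
  Lemma), Cor. 11.35 (the inner product matrix is Hadamard).
* [ChattopadhyayDattaGhosalMukhopadhyay2022] §2, Thm. 2.2 (as used there).
-/

noncomputable section

namespace Literature.Computability.Complexity

open Finset
open Literature.Probability.RandomGraphs.LowDegree (sgn walsh sgn_false sum_walsh_mul_walsh)

variable {n : Type*} [Fintype n] [DecidableEq n]

/-- The `±1` communication matrix of the inner product function `IP(x,y) = Σ xᵢyᵢ mod 2` on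
`{0,1}^n × {0,1}^n` (a Sylvester–Hadamard matrix): `ipSign x y = (-1)^{IP(x,y)}`, written as
the product of the factors `-1` (where `xᵢ = yᵢ = 1`) and `1`. This is the tree's Walsh character
`Literature.Probability.RandomGraphs.LowDegree.walsh` at the support of `x`:
`ipSign x y = walsh {i | xᵢ = 1} y` (`ipSign_eq_walsh`); at `n = Fin k` it is definitionally the
`twist` of `QuantumComplexity/Forrelation.lean` (see the module docstring for the superseded
`twist` lemmas and where the `rfl` bridge goes).
[cite: Jukna2012, Appendix A (Lindsey's Lemma) and proof of Cor. 11.35] -/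
def ipSign (x y : n → Bool) : ℝ :=
  ∏ i, if (x i && y i) = true then -1 else 1

omit [DecidableEq n] in
/-- `ipSign x y = (-1)^{#{i | xᵢ ∧ yᵢ}}`. [cite: Jukna2012, proof of Cor. 11.35] -/
theorem ipSign_eq_pow (x y : n → Bool) :
    ipSign x y = (-1) ^ (univ.filter fun i => (x i && y i) = true).card := by
  unfold ipSign
  rw [prod_ite, prod_const_one, mul_one, prod_const]

omit [DecidableEq n] in
/-- **Bridge to the Boolean-Fourier API of the tree**: `ipSign x y` is the Walsh character
`χ_T(y) = Π_{i ∈ T} (-1)^{yᵢ}` of `LowDegree.lean` at `T = {i | xᵢ = 1}`. [folklore] -/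
theorem ipSign_eq_walsh (x y : n → Bool) :
    ipSign x y = walsh (univ.filter fun i => x i = true) y := by
  unfold ipSign walsh
  rw [prod_filter]
  refine prod_congr rfl fun i _ => ?_
  cases x i <;> cases y i <;> simp [sgn]

/-- The support bijection `{0,1}^n ≃ 𝒫([n])`, `x ↦ {i | xᵢ = 1}` (index sets of Walsh characters
versus points of the cube). [folklore] -/
def boolFunEquivFinset : (n → Bool) ≃ Finset n where
  toFun x := univ.filter fun i => x i = true
  invFun T i := decide (i ∈ T)
  left_inv x := by funext i; simp
  right_inv T := by ext i; simp

omit [DecidableEq n] in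
/-- The entries of the matrix are `±1`. [cite: Jukna2012, Appendix A] -/
theorem ipSign_sq (x y : n → Bool) : ipSign x y ^ 2 = 1 := by
  rw [ipSign_eq_pow, ← pow_mul, mul_comm, pow_mul, neg_one_sq, one_pow]

omit [DecidableEq n] in
/-- The entries of the matrix have absolute value `1`. [cite: Jukna2012, Appendix A] -/
theorem abs_ipSign (x y : n → Bool) : |ipSign x y| = 1 := by
  rw [ipSign_eq_pow, abs_pow, abs_neg, abs_one, one_pow]

omit [DecidableEq n] in
/-- Multiplicativity in the second argument: `H(x,y) H(x,y') = H(x, y ⊕ y')` (the rows of the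
matrix are characters of `(ℤ/2)^n`). [cite: Jukna2012, proof of Cor. 11.35] -/
theorem ipSign_mul_ipSign (x y y' : n → Bool) :
    ipSign x y * ipSign x y' = ipSign x (fun i => xor (y i) (y' i)) := by
  unfold ipSign
  rw [← prod_mul_distrib]
  refine prod_congr rfl fun i _ => ?_
  rcases Bool.eq_false_or_eq_true (x i) with h1 | h1 <;>
    rcases Bool.eq_false_or_eq_true (y i) with h2 | h2 <;>
      rcases Bool.eq_false_or_eq_true (y' i) with h3 | h3 <;> norm_num [h1, h2, h3]

/-- Orthogonality of the rows: `Σ_x H(x,w) = 2^n` if `w = 0` and `0` otherwise ("for every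
`x ≠ 0`, `IP(x,y) = 1` for exactly half of the vectors `y`"); this is the Walsh orthogonality
`LowDegree.sum_walsh_mul_walsh w 0` transported along `boolFunEquivFinset`.
[cite: Jukna2012, proof of Cor. 11.35] -/
theorem sum_ipSign (w : n → Bool) :
    ∑ x : n → Bool, ipSign x w = if w = fun _ => false then (2 : ℝ) ^ Fintype.card n else 0 := by
  have h : ∑ x : n → Bool, ipSign x w =
      ∑ T : Finset n, walsh T w * walsh T (fun _ => false) := by
    rw [← boolFunEquivFinset.sum_comp]
    refine sum_congr rfl fun x _ => ?_
    rw [ipSign_eq_walsh]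
    simp [walsh, boolFunEquivFinset]
  rw [h, sum_walsh_mul_walsh]

/-- **Lindsey's lemma**, weighted and squared: for the `2^n × 2^n` inner-product Hadamard matrix
`H` and real weights `a`, `b`, `(Σ_{x,y} a_x b_y H(x,y))² ≤ (Σ a_x²) · 2^n · (Σ b_y²)`
(Cauchy–Schwarz and `H Hᵀ = 2^n I`). [cite: Jukna2012, Appendix A (Lindsey's Lemma)] -/
theorem lindsey_sq (a b : (n → Bool) → ℝ) :
    (∑ x, ∑ y, a x * b y * ipSign x y) ^ 2 ≤
      (∑ x, a x ^ 2) * ((2 : ℝ) ^ Fintype.card n * ∑ y, b y ^ 2) := by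
  classical
  set F : (n → Bool) → ℝ := fun x => ∑ y, b y * ipSign x y with hF
  have h1 : ∑ x, ∑ y, a x * b y * ipSign x y = ∑ x, a x * F x := by
    refine sum_congr rfl fun x _ => ?_
    rw [hF, mul_sum]
    refine sum_congr rfl fun y _ => ?_
    ring
  have h2 : ∑ x, F x ^ 2 = (2 : ℝ) ^ Fintype.card n * ∑ y, b y ^ 2 := by
    calc ∑ x, F x ^ 2 = ∑ x, ∑ y, ∑ y', b y * b y' * (ipSign x y * ipSign x y') := by
          refine sum_congr rfl fun x _ => ?_
          rw [sq, hF, sum_mul_sum]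
          refine sum_congr rfl fun y _ => sum_congr rfl fun y' _ => ?_
          ring
      _ = ∑ y, ∑ y', b y * b y' * ∑ x, ipSign x (fun i => xor (y i) (y' i)) := by
          rw [sum_comm]
          refine sum_congr rfl fun y _ => ?_
          rw [sum_comm]
          refine sum_congr rfl fun y' _ => ?_
          rw [mul_sum]
          refine sum_congr rfl fun x _ => ?_
          rw [ipSign_mul_ipSign]
      _ = ∑ y, b y * b y * (2 : ℝ) ^ Fintype.card n := by
          refine sum_congr rfl fun y _ => ?_
          simp_rw [sum_ipSign]
          have hiff : ∀ y' : n → Bool, ((fun i => xor (y i) (y' i)) = fun _ => false) ↔ y = y' := by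
            intro y'
            constructor
            · intro h; funext i
              have := congrFun h i
              cases hy : y i <;> cases hy' : y' i <;> simp_all
            · rintro rfl; funext i; simp
          simp_rw [hiff]
          rw [Finset.sum_eq_single y]
          · simp
          · intro y' _ hy'
            rw [if_neg (Ne.symm hy'), mul_zero]
          · simp
      _ = (2 : ℝ) ^ Fintype.card n * ∑ y, b y ^ 2 := by
          rw [mul_sum]
          refine sum_congr rfl fun y _ => ?_
          ring
  rw [h1]
  calc (∑ x, a x * F x) ^ 2 ≤ (∑ x, a x ^ 2) * ∑ x, F x ^ 2 := sum_mul_sq_le_sq_mul_sq _ _ _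
    _ = (∑ x, a x ^ 2) * ((2 : ℝ) ^ Fintype.card n * ∑ y, b y ^ 2) := by rw [h2]

/-- **Lindsey's lemma** for the inner product matrix with weights bounded by `1` in absolute
value (in particular for rectangles `a = 1_S`, `b = 1_T`):
`|Σ_{x,y} a_x b_y (-1)^{IP(x,y)}| ≤ 2^n · √2^n` — the `|S|, |T| ≤ 2^n` instance of Jukna's
`√(ab·N)` with `N = 2^n` (the sharp rectangle form `√(|S||T|2^n)` is `lindsey_sq` with indicator
weights); equivalently the discrepancy of `IP_n` under the uniform distribution is at most
`2^{-n/2}`. [cite: Jukna2012, Appendix A (Lindsey's Lemma)] -/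
theorem lindsey (a b : (n → Bool) → ℝ) (ha : ∀ x, |a x| ≤ 1) (hb : ∀ y, |b y| ≤ 1) :
    |∑ x, ∑ y, a x * b y * ipSign x y| ≤
      (2 : ℝ) ^ Fintype.card n * Real.sqrt 2 ^ Fintype.card n := by
  have hN : ((Fintype.card (n → Bool) : ℕ) : ℝ) = (2 : ℝ) ^ Fintype.card n := by
    rw [Fintype.card_fun, Fintype.card_bool]; push_cast; ring
  have hsa : ∑ x, a x ^ 2 ≤ (2 : ℝ) ^ Fintype.card n := by
    calc ∑ x, a x ^ 2 ≤ ∑ _x : n → Bool, (1 : ℝ) := sum_le_sum fun x _ => by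
            have := ha x
            rw [← sq_abs]; nlinarith [abs_nonneg (a x)]
      _ = (2 : ℝ) ^ Fintype.card n := by
            rw [sum_const, card_univ, nsmul_eq_mul, mul_one, hN]
  have hsb : ∑ y, b y ^ 2 ≤ (2 : ℝ) ^ Fintype.card n := by
    calc ∑ y, b y ^ 2 ≤ ∑ _y : n → Bool, (1 : ℝ) := sum_le_sum fun y _ => by
            have := hb y
            rw [← sq_abs]; nlinarith [abs_nonneg (b y)]
      _ = (2 : ℝ) ^ Fintype.card n := by
            rw [sum_const, card_univ, nsmul_eq_mul, mul_one, hN]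
  have h := lindsey_sq a b
  have h2 : (0 : ℝ) ≤ (2 : ℝ) ^ Fintype.card n := by positivity
  have hsq : (∑ x, ∑ y, a x * b y * ipSign x y) ^ 2 ≤
      ((2 : ℝ) ^ Fintype.card n * Real.sqrt 2 ^ Fintype.card n) ^ 2 := by
    calc _ ≤ (∑ x, a x ^ 2) * ((2 : ℝ) ^ Fintype.card n * ∑ y, b y ^ 2) := h
      _ ≤ (2 : ℝ) ^ Fintype.card n * ((2 : ℝ) ^ Fintype.card n * (2 : ℝ) ^ Fintype.card n) := by
          exact mul_le_mul hsa (mul_le_mul_of_nonneg_left hsb h2)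
            (mul_nonneg h2 (sum_nonneg fun _ _ => sq_nonneg _)) h2
      _ = ((2 : ℝ) ^ Fintype.card n * Real.sqrt 2 ^ Fintype.card n) ^ 2 := by
          rw [mul_pow, ← pow_mul (Real.sqrt 2), mul_comm (Fintype.card n) 2, pow_mul,
            Real.sq_sqrt (by norm_num : (0:ℝ) ≤ 2)]
          ring
  exact abs_le_of_sq_le_sq hsq (by positivity)

end Literature.Computability.Complexity
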